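import Summits.Ventures.QEC.Census.CertBZPlaneSound
import HarnessLib

/-!
# Lane families with FIXED TOP ROWS for qec-type-01's Brouwer–Zimmermann lane engine (finer than `segment`)

Venture QEC (cell `qec`), qec-search-5 gen 2. `Census/CertBZPlane*.lean` (qec-type-01) replays a matrix `G` by `segment t m₀ s`
families — all selections with largest row in `[m₀, m₀+s)`. When a single largest-row block already exceeds what one
declaration can hold (e.g. all vertex sets of size `≤ 11` of a 30-vertex graph code: the block of row `29` alone has
`3.4·10⁷` lanes), a finer split is needed. This file splits by the selection's intersection with the TOP rows:
`topFamily c t k P` = the lanes `S ∪ P`, `S ⊆ [0, c)`, `|S| ≤ t`, for a FIXED set `P ⊆ [c, c+k)` of top rows (type-01's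
colex triangle `catLevels (triAt c t)` for the prefix, plus constant indicator words `ones` / `0` for the `k` top rows), and
`topOK ncols wmax allow G c t k P fuel` = type-01's `familyOK` on it. SOUNDNESS `reaches_of_topFamilies`: if `|G| = c + k`
and for every `P ⊆ [c, c+k)` (enumerated by `(List.range' c k).sublists`, membership in the supplied list `L` checked by
`decide`) the family with budget `t = T − |P|` passes, then `Reaches (bzLeaf wmax allow) (rowPos G 0) T 0 0` — the same
conclusion as `reaches_of_segList`, so every consumer (`matrixEnumOK_of_reaches`, `DistCert.bzZEnum_of_reaches`,
qec-search-5's `AddCert.isAdditiveCode_zero_of_graph`) applies verbatim. For `c = 22`, `k = 8`, `T = 11` (the `[[30,0,12]]`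
seed of CRSS Table III): 256 families of ≤ 2.45·10⁶ lanes. Standard axioms; definitions + theorems.
-/

set_option autoImplicit false

namespace Summit.Ventures.QEC.Census.Plane

open List

/-! ## Definitions -/

/-- Extend a lane family over the rows `[0, c)` by `k` fixed top rows: row `c + i` is selected in EVERY lane iff
`c + i ∈ P`. (definition) -/
def topExtend (fam : ℕ × List ℕ) (c k : ℕ) (P : List ℕ) : ℕ × List ℕ :=
  (fam.1, fam.2 ++ (List.range k).map fun i => if c + i ∈ P then ones fam.1 else 0)

/-- **The top family**: all selections `S ∪ P` with `S ⊆ [0, c)`, `|S| ≤ t` (every size `0 … t`, concatenated levels of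
type-01's colex triangle) and the fixed top rows `P ⊆ [c, c+k)`. (definition) -/
def topFamily (c t k : ℕ) (P : List ℕ) : ℕ × List ℕ := topExtend (catLevels (triAt c t)) c k P

/-- **The top-family check**: type-01's `familyOK` (count the columns `0 … ncols−1`, threshold `wmax + 1`, re-check the
stragglers with `bzLeaf`) on `topFamily c t k P`. (definition) -/
def topOK (ncols wmax : ℕ) (allow G : List ℕ) (c t k : ℕ) (P : List ℕ) (fuel : ℕ) : Bool :=
  familyOK wmax (List.range ncols) allow G (topFamily c t k P) (wmax + 1) fuel

/-! ## Coverage -/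

/-- Levels of the triangle are bounded families with `m` indicator words. -/
theorem triAt_levels (c t : ℕ) :
    ∀ w, w < (triAt c t).length → Bnd ((triAt c t).getD w (0, [])) ∧ ((triAt c t).getD w (0, [])).2.length = c :=
  fun w hw => ⟨(triOK_triAt t c w hw).1, (triOK_triAt t c w hw).2.1⟩

/-- The prefix part of the top family has `c` indicator words. -/
theorem length_catLevels_triAt (c t : ℕ) : (catLevels (triAt c t)).2.length = c :=
  length_catLevels c (triAt c t) (fun w hw => (triAt_levels c t w hw).2)
    (by intro h; have := length_triAt t c; rw [h] at this; simp at this)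

/-- **The top family covers `J ++ P`** for every increasing `J ⊆ [0, c)` with `|J| ≤ t`, when `P ⊆ [c, c + k)`. -/
theorem covers_topFamily (c t k : ℕ) (P : List ℕ) (hP : ∀ p ∈ P, c ≤ p ∧ p < c + k) (J : List ℕ)
    (hJ : J.Pairwise (· < ·)) (hJc : ∀ j ∈ J, j < c) (hJl : J.length ≤ t) :
    Covers (topFamily c t k P) (J ++ P) := by
  -- the level `|J|` of the triangle covers `J`, and `catLevels` keeps it
  have hlev : J.length < (triAt c t).length := by rw [length_triAt]; omega
  have hcov0 : Covers ((triAt c t).getD J.length (0, [])) J := (triOK_triAt t c J.length hlev).2.2 J hJ hJc rfl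
  have hcov : Covers (catLevels (triAt c t)) J :=
    covers_catLevels (triAt c t) (fun w hw => (triAt_levels c t w hw).1) J.length hlev J hcov0
  obtain ⟨b, hb, hbits⟩ := hcov
  refine ⟨b, hb, fun i => ?_⟩
  show (((catLevels (triAt c t)).2 ++ (List.range k).map fun i => if c + i ∈ P then ones (catLevels (triAt c t)).1 else 0).getD i 0).testBit b = decide (i ∈ J ++ P)
  have hlen := length_catLevels_triAt c t
  by_cases hi : i < c
  · -- a prefix row: read the triangle
    rw [List.getD_eq_getElem?_getD, List.getElem?_append_left (by rw [hlen]; exact hi), ← List.getD_eq_getElem?_getD,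
      hbits i]
    have : i ∉ P := fun hp => by have := (hP i hp).1; omega
    simp [List.mem_append, this]
  · -- a top row (or beyond)
    rw [List.getD_eq_getElem?_getD, List.getElem?_append_right (by rw [hlen]; omega), ← List.getD_eq_getElem?_getD,
      hlen]
    have hiJ : i ∉ J := fun hj => hi (hJc i hj)
    by_cases hik : i - c < k
    · rw [List.getD_eq_getElem?_getD, List.getElem?_eq_getElem (by simpa using hik), Option.getD_some, List.getElem_map,
        List.getElem_range, show c + (i - c) = i by omega]
      by_cases hp : i ∈ P
      · rw [if_pos hp, testBit_ones]; simp [hb, hp]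
      · rw [if_neg hp, Nat.zero_testBit]; simp [hp, hiJ]
    · rw [List.getD_eq_getElem?_getD, List.getElem?_eq_none (by simpa using Nat.not_lt.1 hik), Option.getD_none,
        Nat.zero_testBit]
      have : i ∉ P := fun hp => by have := (hP i hp).2; omega
      simp [this, hiJ]

/-! ## Index lists -/

/-- A strictly increasing list with entries in `[c, c + k)` is a sublist of `range' c k`. -/
theorem sublist_range'_of_pairwise (c : ℕ) : ∀ (k : ℕ) (J : List ℕ), J.Pairwise (· < ·) →
    (∀ j ∈ J, c ≤ j ∧ j < c + k) → J.Sublist (List.range' c k)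
  | 0, J, _, hJ => by
    have : J = [] := List.eq_nil_iff_forall_not_mem.2 fun j hj => by have := hJ j hj; omega
    subst this; exact List.Sublist.slnil
  | k + 1, J, hp, hJ => by
    rw [List.range'_succ]
    cases J with
    | nil => exact List.nil_sublist _
    | cons j J' =>
      have hj := hJ j (by simp)
      have hrest : ∀ i ∈ J', c + 1 ≤ i ∧ i < (c + 1) + k := fun i hi => by
        have h1 := hJ i (List.mem_cons_of_mem _ hi)
        have h2 : j < i := List.rel_of_pairwise_cons hp hi
        omega
      have ih := sublist_range'_of_pairwise (c + 1) k J' (List.Pairwise.of_cons hp) hrest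
      by_cases hjc : j = c
      · subst hjc; exact ih.cons_cons _
      · -- `j > c`: the whole list lives in `[c+1, c+1+k)`
        have hall : ∀ i ∈ j :: J', c + 1 ≤ i ∧ i < (c + 1) + k := fun i hi => by
          rcases List.mem_cons.1 hi with rfl | hi
          · omega
          · exact hrest i hi
        exact (sublist_range'_of_pairwise (c + 1) k (j :: J') hp hall).cons _

/-! ## Assembly -/

/-- **SOUNDNESS OF THE TOP-FAMILY REPLAY.** Let the rows of `G` (`|G| = c + k`) be words below `2^ncols`. If for every
set `P` of top rows (every sublist of `range' c k`, all listed in `L`) the top family with budget `T − |P|` passes, then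
`bzLeaf wmax allow` holds at every sub-selection of `≤ T` rows of `G`: `Reaches (bzLeaf wmax allow) (rowPos G 0) T 0 0`. -/
theorem reaches_of_topFamilies (ncols wmax : ℕ) (allow G : List ℕ) (c k T fuel : ℕ) (hG : ∀ g ∈ G, g < 2 ^ ncols)
    (hlen : G.length = c + k) (L : List (List ℕ))
    (hL : ((List.range' c k).sublists.all fun P => L.elem P) = true)
    (hok : ∀ P ∈ L, P.length ≤ T → topOK ncols wmax allow G c (T - P.length) k P fuel = true) :
    Reaches (bzLeaf wmax allow) (rowPos G 0) T 0 0 := by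
  intro S hS hSl
  rw [Nat.zero_xor, Nat.zero_xor]
  obtain ⟨J, hJsub, rfl⟩ := exists_map_of_sublist_rowPos G hS
  have hJp : J.Pairwise (· < ·) := List.Pairwise.sublist hJsub List.pairwise_lt_range
  have hJlt : ∀ j ∈ J, j < G.length := fun j hj => List.mem_range.1 (hJsub.subset hj)
  rw [List.length_map] at hSl
  -- split `J` into the prefix part and the top part
  set J1 := J.filter fun j => decide (j < c) with hJ1
  set P := J.filter fun j => decide (c ≤ j) with hPdef
  have hJ1c : ∀ j ∈ J1, j < c := fun j hj => by simpa using (List.mem_filter.1 hj).2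
  have hPc : ∀ p ∈ P, c ≤ p ∧ p < c + k := fun p hp => by
    obtain ⟨hpJ, hpc⟩ := List.mem_filter.1 hp
    exact ⟨by simpa using hpc, hlen ▸ hJlt p hpJ⟩
  have hJ1p : J1.Pairwise (· < ·) := hJp.filter _
  have hPp : P.Pairwise (· < ·) := hJp.filter _
  have hPsub : P.Sublist (List.range' c k) := sublist_range'_of_pairwise c k P hPp hPc
  have hPL : P ∈ L := by
    rw [List.all_eq_true] at hL
    have := hL P (List.mem_sublists.2 hPsub)
    exact List.mem_of_elem_eq_true this
  have hlenJ : J1.length + P.length = J.length := by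
    have e2 : ∀ j : ℕ, (!decide (j < c)) = decide (c ≤ j) := fun j => by
      by_cases h : j < c
      · simp [h, Nat.not_le.2 h]
      · simp [h, Nat.not_lt.1 h]
    have h := List.length_eq_length_filter_add (fun j => decide (j < c)) (l := J)
    rw [List.filter_congr (fun j _ => e2 j)] at h
    rw [hJ1, hPdef]; exact h.symm
  have hPT : P.length ≤ T := by omega
  have hfam := hok P hPL hPT
  rw [topOK] at hfam
  have hmem : ∀ i, (i ∈ J1 ++ P) ↔ i ∈ J := fun i => by
    rw [List.mem_append, hJ1, hPdef, List.mem_filter, List.mem_filter]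
    constructor
    · rintro (⟨h, -⟩ | ⟨h, -⟩) <;> exact h
    · intro h; by_cases hic : i < c
      · exact Or.inl ⟨h, by simpa using hic⟩
      · exact Or.inr ⟨h, by simpa using Nat.not_lt.1 hic⟩
  obtain ⟨b, hb, hbits⟩ := covers_topFamily c (T - P.length) k P hPc J1 hJ1p hJ1c (by omega)
  have hbits' : ∀ i, ((topFamily c (T - P.length) k P).2.getD i 0).testBit b = decide (i ∈ J) := fun i => by
    rw [hbits i]; exact Bool.decide_congr (hmem i)
  have hsel := laneSel_eq_of_covers b G (topFamily c (T - P.length) k P).2 J hJp hbits' hJlt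
  rcases familyOK_sound (Nat.succ_pos wmax) hfam b hb with hcnt | hleaf
  · -- at least `wmax + 1` set bits among the columns: the weight test fires
    rw [hsel] at hcnt
    simp only at hcnt
    rw [length_filter_range_testBit] at hcnt
    have hclt : xorSnd (J.map fun j => (2 ^ j, G.getD j 0)) < 2 ^ ncols := by
      rw [xorSnd_map_pair]
      refine xorList_lt ncols _ fun x hx => ?_
      obtain ⟨j, hj, rfl⟩ := List.mem_map.1 hx
      have hjl := hJlt j hj
      rw [List.getD_eq_getElem?_getD, List.getElem?_eq_getElem hjl, Option.getD_some]
      exact hG _ (List.getElem_mem hjl)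
    have hwt := wtGt_of_lt_popc ncols wmax _ hclt (by omega)
    rw [bzLeaf, hwt]
    simp only [Bool.or_true, Bool.true_or]
  · rw [hsel] at hleaf
    exact hleaf

/-! ## Controls (the Steane matrix of `Census/CertCheckBZ.lean`: 4 rows of 7 bits) -/

/-- Control: with `c = 2`, `k = 2`, budget `2`, the four top families of the Steane matrix pass at threshold `3`
(every nonempty selection of ≤ 2 rows has weight ≥ 3) … -/
theorem topOK_steane :
    (topOK 7 2 [] steaneG 2 2 2 [] 1 && topOK 7 2 [] steaneG 2 1 2 [2] 1 && topOK 7 2 [] steaneG 2 1 2 [3] 1 &&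
      topOK 7 2 [] steaneG 2 0 2 [2, 3] 1) = true := by
  decide

/-- … hence the depth-2 replay of the Steane matrix through top families (tier KERNEL). -/
theorem reaches_steane_top : Reaches (bzLeaf 2 []) (rowPos steaneG 0) 2 0 0 := by
  have h := topOK_steane
  simp only [Bool.and_eq_true] at h
  obtain ⟨⟨⟨h0, h1⟩, h2⟩, h3⟩ := h
  refine reaches_of_topFamilies 7 2 [] steaneG 2 2 2 1 (by decide) (by decide) [[], [2], [3], [2, 3]] (by decide) ?_
  intro P hP _
  simp only [List.mem_cons, List.mem_nil_iff, or_false] at hP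
  rcases hP with rfl | rfl | rfl | rfl
  · exact h0
  · exact h1
  · exact h2
  · exact h3

/-- Negative control: with `wmax = 4` (threshold `5`) the no-fixed-row family of the Steane matrix is REJECTED (its
rows have weight `4`). -/
theorem topOK_steane_neg : topOK 7 4 [] steaneG 2 2 2 [] 1 = false := by decide

end Summit.Ventures.QEC.Census.Plane
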